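import Summits.ResolutionOfSingularities.ResolutionOfSingularities.Theorems.WildPurityWildSymbolSymbolCalculus
import HarnessLib

/-!
# `WildSymbol` (stmt-ResolutionOfSingularities-17133), line `birth` — calibration:
# zero-dimensional discrete places absorb all of `H³_p(K)`

Support file for crux #2 of route `ResolutionOfSingularities/WildPurity`
(`Summit.ResolutionOfSingularities.ResolutionOfSingularities.Theses.WildPurity.WildSymbol`, the ∃-witness
`(p, k, K, O, R, α)`: `α ∈ H³_p(K) = G ⧸ N` integral at every divisorial `W ⊇ R` centred inside the centre
of `O`, yet `α ∉ Unr O`), line `birth` (periodic-tower cut; definitions in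
`Theorems/WildPurityWildSymbolBirthDefs.lean`). Written by the line lead as the calibration half of the
load-bearing stub `stub_selfSimilarGerm` (registered sub-goal `not_wildSymbol_at_arc_place`).

## Content (the symbol calculus `sym_*` used below is `Theorems/WildPurityWildSymbolSymbolCalculus.lean`)

1. **`unr_eq_top_of_uniformizer`** — if a valuation ring `O` of `K` (char `p`) has a non-unit `t` with
   every non-zero element of `O` of the form `tᵐ · unit` and every element of `O` a `p`-th power modulo
   `t`, then `Unr O = ⊤`: EVERY class of `H³_p(K)` is a sum of `O`-integral symbols. Proof: write the
   logarithmic entries as `tᶻ · unit`; `[a, t, w}` and `[a, u, w}` (`u, w` units) are integral by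
   induction on the pole order of `a` — expanding `w = eᵖ + t w₁`, `w₁ = tᵐ w₂` and using `sym_d_add`
   trades `[t a, t, w}` for `[t a', t, w₂}` with `a' = a t w₁ / w` strictly more integral, and at the
   bottom `[t a, t, w} = [a (1+t), 1+t, w}` is integral (`sym_shift`). (This is the finite shadow, inside
   the symbolic presentation, of `Ω²_{K̂} = 0` for `K̂ = κ((t))` with `κ` perfect.)
2. **`unr_eq_top_of_dvr_of_perfect_residue`** — a DVR of `K` (char `p`) with perfect residue field
   (every element a `p`-th power modulo `𝔪_O`) absorbs `H³_p(K)`; **`unr_eq_top_of_dvr_of_residueField`**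
   — in particular a DVR `O ⊇ k` of `K/k` with residue field `k` (`k` perfect).
3. **`not_wildSymbol_at_dvr_of_perfect_residue`**, **`not_wildSymbol_at_arc_place`** — CALIBRATION
   (negative lemmas): the crux with the extra hypotheses "`O` is a DVR with perfect residue field", resp.
   "`O` is a DVR with residue field `k`" is FALSE, whatever `R` and condition (D). When trdeg `K/k ≥ 2`
   these zero-dimensional discrete places (`K ↪ k((t))` along a transcendental formal arc) are NOT in
   the tested divisorial class (not essentially of finite type) and are the prototype of non-Abhyankar
   places with defect (`K̂/Kʰ` inseparable) — so this is a new excluded region beyond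
   `Negative/LoadBearing.lean` (divisorial `O`) and `Negative/HeightOneCentre.lean`, and the first class
   of defect-prone places shown to carry no degree-3 witness ("degree-3 classes are blind there", the
   route's own why-it-might-fail, made a theorem for these places). For the line `birth`: the basin ring
   `⋃ σⁿ(S)` of a self-similar germ is a `σ`-stable valuation ring; whenever it is discrete with residue
   field `k` — e.g. the branch valuation of the transcendental invariant curve `y = Σ q^{-n(n+1)/2} xⁿ`
   of `(x, y) ↦ (x/q, qy/x − 1)` on `k(x,y)`, the first non-Abhyankar basin one writes down — no germ
   exists. Live basins must be non-discrete (value group `p`-divisible, rational rank 1) or of higher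
   rational rank with small residue field.

No definition is declared; nothing concludes the crux positively.
-/

noncomputable section

-- single-problem summit: the doubled namespace component `ResolutionOfSingularities` is forced
set_option linter.dupNamespace false

namespace Summit.ResolutionOfSingularities.ResolutionOfSingularities.Theorems.WildSymbol.Birth

open Summit.ResolutionOfSingularities.ResolutionOfSingularities.Theses.WildPurity (WildSymbol)

/-! ## Zero-dimensional discrete places absorb `H³_p` -/

section Arc

variable {p : ℕ} {K : Type} [Field K]

set_option quotPrecheck false in
local notation "⟪" a ", " b ", " c "⟫" =>
  (((FreeAbelianGroup.of (((a : K), (b : Kˣ), (c : Kˣ)) : K × Kˣ × Kˣ) : G K)) : G K ⧸ N p K)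

/-- An `O`-integral symbol with unit logarithmic entries is in `Unr O` (membership form used
throughout). [folklore] -/
theorem sym_mem_Unr_of_units (O : ValuationSubring K) {a : K} {b c : Kˣ} (ha : a ∈ O)
    (hb : (b : K) ∈ O) (hbu : (b : K) ∉ O.nonunits) (hc : (c : K) ∈ O) (hcu : (c : K) ∉ O.nonunits) :
    ⟪a, b, c⟫ ∈ Unr p K O.toSubring := by
  refine sym_mem_Unr ha hb ?_ hc ?_
  · rw [Units.val_inv_eq_inv_val]; exact inv_mem_of_not_mem_nonunits O hbu
  · rw [Units.val_inv_eq_inv_val]; exact inv_mem_of_not_mem_nonunits O hcu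

/-- Every element of `K` becomes `O`-integral after multiplication by a power of the uniformizer.
[folklore] -/
theorem exists_pow_mul_mem (O : ValuationSubring K) (t : Kˣ)
    (hdisc : ∀ x : K, x ∈ O → x ≠ 0 → ∃ (m : ℕ) (w : K), w ∈ O ∧ w ∉ O.nonunits ∧ x = (t : K) ^ m * w)
    (x : K) : ∃ n : ℕ, (t : K) ^ n * x ∈ O := by
  rcases O.mem_or_inv_mem x with hx | hx
  · exact ⟨0, by simpa using hx⟩
  · by_cases hx0 : x = 0
    · exact ⟨0, by simp [hx0, O.zero_mem]⟩
    obtain ⟨m, w, -, hwu, hw⟩ := hdisc x⁻¹ hx (inv_ne_zero hx0)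
    refine ⟨m, ?_⟩
    have : (t : K) ^ m * x = w⁻¹ := by
      have hx' : x = ((t : K) ^ m * w)⁻¹ := by rw [← hw, inv_inv]
      rw [hx', mul_inv, ← mul_assoc, mul_inv_cancel₀ (pow_ne_zero _ t.ne_zero), one_mul]
    rw [this]
    exact inv_mem_of_not_mem_nonunits O hwu

/-- **Claim A.** `[t a, t, w} ∈ Unr O` for every unit `w` of `O`, by induction on the pole order of
`a`: expand `w = eᵖ + t w₁`, `w₁ = tᵐ w₂`; then `[ta, t, w} = [t a', t, w₂}` with `a' = a t w₁ / w` one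
step more integral; at the bottom `[t a, t, w} = [a(1+t), 1+t, w}` is integral. [folklore] -/
theorem claimA [CharP K p] (hp : p ≠ 0) (O : ValuationSubring K) (t : Kˣ) (ht : (t : K) ∈ O.nonunits)
    (hdisc : ∀ x : K, x ∈ O → x ≠ 0 → ∃ (m : ℕ) (w : K), w ∈ O ∧ w ∉ O.nonunits ∧ x = (t : K) ^ m * w)
    (hres : ∀ u : K, u ∈ O → ∃ e u' : K, u' ∈ O ∧ u = e ^ p + t * u')
    (n : ℕ) : ∀ (a : K) (w : Kˣ), (w : K) ∈ O → (w : K) ∉ O.nonunits →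
      (t : K) ^ n * a ∈ O → ⟪(t : K) * a, t, w⟫ ∈ Unr p K O.toSubring := by
  have htO : (t : K) ∈ O := O.nonunits_subset ht
  induction n with
  | zero =>
    intro a w hwO hwu ha
    rw [pow_zero, one_mul] at ha
    have h1t : (1 : K) + t ≠ 0 := ne_zero_of_not_mem_nonunits O (one_add_not_mem_nonunits O ht)
    obtain ⟨t1, ht1⟩ : ∃ t1 : Kˣ, (t1 : K) = 1 + t := ⟨Units.mk0 (1 + t) h1t, rfl⟩
    rw [sym_shift ((t : K) * a) t t1 w ht1]
    have : (t : K) * a * ↑t⁻¹ * ↑t1 = a * (1 + t) := by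
      rw [Units.val_inv_eq_inv_val, mul_comm (t : K) a, mul_assoc a, mul_inv_cancel₀ t.ne_zero,
        mul_one, ht1]
    rw [this]
    have h1tO : (1 : K) + t ∈ O := O.add_mem _ _ O.one_mem htO
    exact sym_mem_Unr_of_units O (O.mul_mem _ _ ha h1tO) (ht1 ▸ h1tO)
      (ht1 ▸ one_add_not_mem_nonunits O ht) hwO hwu
  | succ n ih =>
    intro a w hwO hwu ha
    obtain ⟨e, w₁, hw₁O, hw⟩ := hres w hwO
    by_cases hw₁ : w₁ = 0
    · -- `w = eᵖ`: the symbol dies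
      have he : e ≠ 0 := by
        rintro rfl
        apply w.ne_zero
        rw [hw, hw₁, mul_zero, add_zero, zero_pow hp]
      obtain ⟨E, rfl⟩ : ∃ E : Kˣ, (E : K) = e := ⟨Units.mk0 e he, rfl⟩
      have hwE : w = E ^ p := Units.ext (by rw [Units.val_pow_eq_pow_val, hw, hw₁, mul_zero, add_zero])
      rw [sym_antisymm, hwE, sym_pow_p_mid, neg_zero]
      exact (Unr p K O.toSubring).zero_mem
    · have he : e ≠ 0 := by
        rintro rfl
        apply hwu
        rw [hw, zero_pow hp, zero_add]
        exact mul_mem_nonunits O ht hw₁O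
      obtain ⟨m, w₂, hw₂O, hw₂u, hw₁eq⟩ := hdisc w₁ hw₁O hw₁
      have hw₂0 : w₂ ≠ 0 := ne_zero_of_not_mem_nonunits O hw₂u
      obtain ⟨E, rfl⟩ : ∃ E : Kˣ, (E : K) = e := ⟨Units.mk0 e he, rfl⟩
      obtain ⟨W₁, rfl⟩ : ∃ W : Kˣ, (W : K) = w₁ := ⟨Units.mk0 w₁ hw₁, rfl⟩
      obtain ⟨W₂, rfl⟩ : ∃ W : Kˣ, (W : K) = w₂ := ⟨Units.mk0 w₂ hw₂0, rfl⟩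
      have hW₁ : W₁ = t ^ m * W₂ := Units.ext (by rw [Units.val_mul, Units.val_pow_eq_pow_val, hw₁eq])
      have hs : (w : K) = ↑(E ^ p) + ↑(t * W₁) := by rw [Units.val_pow_eq_pow_val, Units.val_mul, hw]
      -- `d`-additivity in the middle slot against `t` in the last slot
      have hd := sym_d_add (p := p) ((t : K) * a * ↑w⁻¹) (E ^ p) (t * W₁) w t hs
      rw [Units.inv_mul_cancel_right, sym_pow_p_mid, zero_add] at hd
      rw [sym_antisymm, ← hd, sym_mul_mid _ t W₁, sym_diag, zero_add, hW₁, sym_mul_mid _ (t ^ m) W₂,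
        sym_pow_mid, sym_diag, smul_zero, zero_add, sym_antisymm _ W₂ t, neg_neg]
      have key : (t : K) * a * ↑w⁻¹ * ↑(t * (t ^ m * W₂)) = (t : K) * (a * ↑w⁻¹ * ↑(t * (t ^ m * W₂))) := by
        ring
      rw [key]
      refine ih _ W₂ hw₂O hw₂u ?_
      have : (t : K) ^ n * (a * ↑w⁻¹ * ↑(t * (t ^ m * W₂)))
          = ((t : K) ^ (n + 1) * a) * (↑w⁻¹ * ((t : K) ^ m * ↑W₂)) := by
        push_cast; ring
      rw [this]
      refine O.mul_mem _ _ ha (O.mul_mem _ _ ?_ (O.mul_mem _ _ (O.toSubring.pow_mem htO m) hw₂O))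
      rw [Units.val_inv_eq_inv_val]
      exact inv_mem_of_not_mem_nonunits O hwu

/-- **Claim B.** `[a, u, w} ∈ Unr O` for all units `u, w` of `O` and every `a ∈ K`, by the same
induction: expand `u = eᵖ + t u₁`, `u₁ = tᵐ u₂`; `[a, u, w} = (1+m)[a', t, w} + [a', u₂, w}` with
`a' = a t u₁/u` one step more integral (Claim A handles the first part). [folklore] -/
theorem claimB [CharP K p] (hp : p ≠ 0) (O : ValuationSubring K) (t : Kˣ) (ht : (t : K) ∈ O.nonunits)
    (hdisc : ∀ x : K, x ∈ O → x ≠ 0 → ∃ (m : ℕ) (w : K), w ∈ O ∧ w ∉ O.nonunits ∧ x = (t : K) ^ m * w)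
    (hres : ∀ u : K, u ∈ O → ∃ e u' : K, u' ∈ O ∧ u = e ^ p + t * u')
    (n : ℕ) : ∀ (a : K) (u w : Kˣ), (u : K) ∈ O → (u : K) ∉ O.nonunits → (w : K) ∈ O →
      (w : K) ∉ O.nonunits → (t : K) ^ n * a ∈ O → ⟪a, u, w⟫ ∈ Unr p K O.toSubring := by
  -- Claim A for an arbitrary first entry
  have hA : ∀ (a : K) (w : Kˣ), (w : K) ∈ O → (w : K) ∉ O.nonunits →
      ⟪a, t, w⟫ ∈ Unr p K O.toSubring := by
    intro a w hwO hwu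
    obtain ⟨n, hn⟩ := exists_pow_mul_mem O t hdisc (↑t⁻¹ * a)
    have h := claimA hp O t ht hdisc hres n (↑t⁻¹ * a) w hwO hwu hn
    rwa [Units.mul_inv_cancel_left] at h
  induction n with
  | zero =>
    intro a u w huO huu hwO hwu ha
    rw [pow_zero, one_mul] at ha
    exact sym_mem_Unr_of_units O ha huO huu hwO hwu
  | succ n ih =>
    intro a u w huO huu hwO hwu ha
    obtain ⟨e, u₁, hu₁O, hu⟩ := hres u huO
    by_cases hu₁ : u₁ = 0
    · have he : e ≠ 0 := by
        rintro rfl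
        apply u.ne_zero
        rw [hu, hu₁, mul_zero, add_zero, zero_pow hp]
      obtain ⟨E, rfl⟩ : ∃ E : Kˣ, (E : K) = e := ⟨Units.mk0 e he, rfl⟩
      have huE : u = E ^ p := Units.ext (by rw [Units.val_pow_eq_pow_val, hu, hu₁, mul_zero, add_zero])
      rw [huE, sym_pow_p_mid]
      exact (Unr p K O.toSubring).zero_mem
    · have he : e ≠ 0 := by
        rintro rfl
        apply huu
        rw [hu, zero_pow hp, zero_add]
        exact mul_mem_nonunits O ht hu₁O
      obtain ⟨m, u₂, hu₂O, hu₂u, hu₁eq⟩ := hdisc u₁ hu₁O hu₁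
      have hu₂0 : u₂ ≠ 0 := ne_zero_of_not_mem_nonunits O hu₂u
      obtain ⟨E, rfl⟩ : ∃ E : Kˣ, (E : K) = e := ⟨Units.mk0 e he, rfl⟩
      obtain ⟨U₁, rfl⟩ : ∃ U : Kˣ, (U : K) = u₁ := ⟨Units.mk0 u₁ hu₁, rfl⟩
      obtain ⟨U₂, rfl⟩ : ∃ U : Kˣ, (U : K) = u₂ := ⟨Units.mk0 u₂ hu₂0, rfl⟩
      have hU₁ : U₁ = t ^ m * U₂ := Units.ext (by rw [Units.val_mul, Units.val_pow_eq_pow_val, hu₁eq])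
      have hs : (u : K) = ↑(E ^ p) + ↑(t * U₁) := by rw [Units.val_pow_eq_pow_val, Units.val_mul, hu]
      have hd := sym_d_add (p := p) (a * ↑u⁻¹) (E ^ p) (t * U₁) u w hs
      rw [Units.inv_mul_cancel_right, sym_pow_p_mid, zero_add] at hd
      rw [← hd, sym_mul_mid _ t U₁, hU₁, sym_mul_mid _ (t ^ m) U₂, sym_pow_mid]
      refine (Unr p K O.toSubring).add_mem (hA _ _ hwO hwu)
        ((Unr p K O.toSubring).add_mem ((Unr p K O.toSubring).nsmul_mem (hA _ _ hwO hwu) m) ?_)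
      refine ih _ U₂ w hu₂O hu₂u hwO hwu ?_
      have : (t : K) ^ n * (a * ↑u⁻¹ * ↑(t * (t ^ m * U₂)))
          = ((t : K) ^ (n + 1) * a) * (↑u⁻¹ * ((t : K) ^ m * ↑U₂)) := by
        push_cast; ring
      rw [this]
      have htO : (t : K) ∈ O := O.nonunits_subset ht
      refine O.mul_mem _ _ ha (O.mul_mem _ _ ?_ (O.mul_mem _ _ (O.toSubring.pow_mem htO m) hu₂O))
      rw [Units.val_inv_eq_inv_val]
      exact inv_mem_of_not_mem_nonunits O huu

/-- Every unit of `K` is `tᶻ · (unit of O)`. [folklore] -/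
theorem exists_eq_zpow_mul_unit (O : ValuationSubring K) (t : Kˣ)
    (hdisc : ∀ x : K, x ∈ O → x ≠ 0 → ∃ (m : ℕ) (w : K), w ∈ O ∧ w ∉ O.nonunits ∧ x = (t : K) ^ m * w)
    (b : Kˣ) : ∃ (z : ℤ) (w : Kˣ), (w : K) ∈ O ∧ (w : K) ∉ O.nonunits ∧ b = t ^ z * w := by
  rcases O.mem_or_inv_mem (b : K) with hb | hb
  · obtain ⟨m, w, hwO, hwu, hbw⟩ := hdisc _ hb b.ne_zero
    obtain ⟨W, rfl⟩ : ∃ W : Kˣ, (W : K) = w := ⟨Units.mk0 w (ne_zero_of_not_mem_nonunits O hwu), rfl⟩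
    refine ⟨m, W, hwO, hwu, Units.ext ?_⟩
    rw [Units.val_mul, zpow_natCast, Units.val_pow_eq_pow_val]
    exact hbw
  · obtain ⟨m, w, hwO, hwu, hbw⟩ := hdisc _ hb (inv_ne_zero b.ne_zero)
    obtain ⟨W, rfl⟩ : ∃ W : Kˣ, (W : K) = w := ⟨Units.mk0 w (ne_zero_of_not_mem_nonunits O hwu), rfl⟩
    refine ⟨-(m : ℤ), W⁻¹, ?_, ?_, Units.ext ?_⟩
    · rw [Units.val_inv_eq_inv_val]; exact inv_mem_of_not_mem_nonunits O hwu
    · rw [Units.val_inv_eq_inv_val]; exact inv_not_mem_nonunits O hwO hwu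
    · rw [zpow_neg, zpow_natCast, Units.val_mul, Units.val_inv_eq_inv_val, Units.val_inv_eq_inv_val,
        Units.val_pow_eq_pow_val, ← mul_inv, ← hbw, inv_inv]

/-- **Zero-dimensional discrete places absorb `H³_p`.** Let `O` be a valuation ring of a field `K`
of characteristic `p` with a non-unit `t` such that (1) every non-zero element of `O` is `tᵐ · unit`
(`O` is discrete of rank one with uniformizer `t`) and (2) every element of `O` is a `p`-th power
modulo `t` (the residue field is perfect and its Teichmüller-type lifts exist in `K` — e.g. `k ⊆ O`
perfect mapping onto the residue field). Then EVERY class of the symbolic `H³_p(K) = G ⧸ N` is a sum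
of `O`-integral symbols: `Unr O = ⊤`. (Heuristic: `K̂ = κ((t))` with `κ` perfect has `Ω²_{K̂} = 0`;
the proof is the finite shadow `du ∧ dv ∈ tᴺ Ω²` of that, run inside the symbolic presentation.)
[folklore] -/
theorem unr_eq_top_of_uniformizer [CharP K p] (hp : p ≠ 0) (O : ValuationSubring K) (t : Kˣ)
    (ht : (t : K) ∈ O.nonunits)
    (hdisc : ∀ x : K, x ∈ O → x ≠ 0 → ∃ (m : ℕ) (w : K), w ∈ O ∧ w ∉ O.nonunits ∧ x = (t : K) ^ m * w)
    (hres : ∀ u : K, u ∈ O → ∃ e u' : K, u' ∈ O ∧ u = e ^ p + t * u') :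
    Unr p K O.toSubring = ⊤ := by
  have hA : ∀ (a : K) (w : Kˣ), (w : K) ∈ O → (w : K) ∉ O.nonunits →
      ⟪a, t, w⟫ ∈ Unr p K O.toSubring := by
    intro a w hwO hwu
    obtain ⟨n, hn⟩ := exists_pow_mul_mem O t hdisc (↑t⁻¹ * a)
    have h := claimA hp O t ht hdisc hres n (↑t⁻¹ * a) w hwO hwu hn
    rwa [Units.mul_inv_cancel_left] at h
  have hB : ∀ (a : K) (u w : Kˣ), (u : K) ∈ O → (u : K) ∉ O.nonunits → (w : K) ∈ O →
      (w : K) ∉ O.nonunits → ⟪a, u, w⟫ ∈ Unr p K O.toSubring := by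
    intro a u w huO huu hwO hwu
    obtain ⟨n, hn⟩ := exists_pow_mul_mem O t hdisc a
    exact claimB hp O t ht hdisc hres n a u w huO huu hwO hwu hn
  apply eq_top_of_forall_sym_mem
  intro a b c
  obtain ⟨z, w, hwO, hwu, rfl⟩ := exists_eq_zpow_mul_unit O t hdisc b
  obtain ⟨z', w', hw'O, hw'u, rfl⟩ := exists_eq_zpow_mul_unit O t hdisc c
  rw [sym_mul_mid a (t ^ z) w (t ^ z' * w'), sym_zpow_mid a t (t ^ z' * w') z,
    sym_mul_right a t (t ^ z') w', sym_zpow_right a t t z', sym_diag a t, smul_zero, zero_add,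
    sym_mul_right a w (t ^ z') w', sym_zpow_right a w t z']
  refine (Unr p K O.toSubring).add_mem ((Unr p K O.toSubring).zsmul_mem (hA a w' hw'O hw'u) z)
    ((Unr p K O.toSubring).add_mem ((Unr p K O.toSubring).zsmul_mem ?_ z') (hB a w w' hwO hwu hw'O hw'u))
  rw [sym_antisymm]
  exact (Unr p K O.toSubring).neg_mem (hA a w hwO hwu)

/-- **A discrete valuation ring of a field of characteristic `p` with PERFECT residue field absorbs
`H³_p(K)`: `Unr O = ⊤`.** Perfectness is stated without the residue field: every element of `O` is a
`p`-th power modulo `𝔪_O`. (For a henselian such `O` this is Kato's `H³_p(K) ≅ H³_p(κ) ⊕ H²_p(κ) = 0`,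
`κ` perfect; the point is that integrality already holds for `K` itself, with no henselisation.)
[folklore] -/
theorem unr_eq_top_of_dvr_of_perfect_residue {p : ℕ} (hp : p.Prime) {K : Type} [Field K] [CharP K p]
    (O : ValuationSubring K) (hdvr : IsDiscreteValuationRing O)
    (hperf : ∀ u : K, u ∈ O → ∃ e : K, u - e ^ p ∈ O.nonunits) :
    Unr p K O.toSubring = ⊤ := by
  haveI := hdvr
  obtain ⟨ϖ, hϖ⟩ := IsDiscreteValuationRing.exists_irreducible O
  have hϖ0 : (ϖ : K) ≠ 0 := fun h => hϖ.ne_zero (Subtype.ext h)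
  obtain ⟨t, htϖ⟩ : ∃ t : Kˣ, (t : K) = ϖ := ⟨Units.mk0 (ϖ : K) hϖ0, rfl⟩
  have ht : (t : K) ∈ O.nonunits := by
    rw [htϖ, ValuationSubring.coe_mem_nonunits_iff, IsLocalRing.mem_maximalIdeal, mem_nonunits_iff]
    exact hϖ.not_isUnit
  refine unr_eq_top_of_uniformizer hp.ne_zero O t ht ?_ ?_
  · intro x hxO hx0
    have hx0' : (⟨x, hxO⟩ : O) ≠ 0 := fun h => hx0 (congrArg Subtype.val h)
    obtain ⟨m, u, hu⟩ := IsDiscreteValuationRing.eq_unit_mul_pow_irreducible hx0' hϖ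
    refine ⟨m, ((u : O) : K), (u : O).2, ?_, ?_⟩
    · rw [ValuationSubring.coe_mem_nonunits_iff, IsLocalRing.mem_maximalIdeal, mem_nonunits_iff]
      exact fun h => h (Units.isUnit u)
    · have hx : x = ((u : O) : K) * (ϖ : K) ^ m := by
        have := congrArg Subtype.val hu
        simpa using this
      rw [hx, mul_comm, htϖ]
  · intro u huO
    obtain ⟨e, he⟩ := hperf u huO
    have hmem : u - e ^ p ∈ O := O.nonunits_subset he
    have hmax : (⟨u - e ^ p, hmem⟩ : O) ∈ IsLocalRing.maximalIdeal O :=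
      ValuationSubring.coe_mem_nonunits_iff.mp he
    rw [hϖ.maximalIdeal_eq, Ideal.mem_span_singleton'] at hmax
    obtain ⟨r, hr⟩ := hmax
    refine ⟨e, (r : K), r.2, ?_⟩
    have h2 : (r : K) * (ϖ : K) = u - e ^ p := by
      have := congrArg Subtype.val hr
      simpa using this
    rw [htϖ, mul_comm, h2]
    ring

/-- **A discrete valuation ring `O ⊇ k` of `K/k` with residue field `k` (k perfect of characteristic
`p`) absorbs `H³_p(K)`: `Unr O = ⊤`.** These are exactly the zero-dimensional discrete places
(e.g. `K ↪ k((t))` along a transcendental formal arc; never divisorial when trdeg `K/k ≥ 2`, the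
prototype of a non-Abhyankar place with defect). [folklore] -/
theorem unr_eq_top_of_dvr_of_residueField {p : ℕ} (hp : p.Prime) {k K : Type} [Field k] [CharP k p]
    [PerfectField k] [Field K] [CharP K p] [Algebra k K] (O : ValuationSubring K)
    (hdvr : IsDiscreteValuationRing O)
    (hres : ∀ u : K, u ∈ O → ∃ c : k, u - algebraMap k K c ∈ O.nonunits) :
    Unr p K O.toSubring = ⊤ := by
  haveI := Fact.mk hp
  refine unr_eq_top_of_dvr_of_perfect_residue hp O hdvr fun u huO => ?_
  obtain ⟨c, hc⟩ := hres u huO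
  refine ⟨algebraMap k K ((frobeniusEquiv k p).symm c), ?_⟩
  rwa [← map_pow, frobeniusEquiv_symm_pow_p]

/-- **CALIBRATION (negative lemma): no `WildSymbol` witness at a discrete place with perfect residue
field.** The crux with the extra hypotheses "`O` is a DVR" and "every element of `O` is a `p`-th power
modulo `𝔪_O`" is FALSE (`Unr O = ⊤` kills condition (N)). In the line `birth` this excludes every
self-similar germ at a CLOSED point whose basin ring `⋃ σⁿ(S)` is discrete: its residue field is a
directed union of the finite extensions `κ(σⁿ S) ≅ κ(S)` of the perfect field `k`, hence perfect.
[folklore] -/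
theorem not_wildSymbol_at_dvr_of_perfect_residue :
    ¬ ∃ p : ℕ, p.Prime ∧ ∃ (k K : Type) (_ : Field k) (_ : CharP k p) (_ : PerfectField k) (_ : Field K)
      (_ : Algebra k K), (⊤ : IntermediateField k K).FG ∧ ∃ O : ValuationSubring K,
      (∀ c : k, algebraMap k K c ∈ O) ∧ IsDiscreteValuationRing O ∧
      (∀ u : K, u ∈ O → ∃ e : K, u - e ^ p ∈ O.nonunits) ∧
      ∃ R : Subalgebra k K, R.FG ∧ R.toSubring ≤ O.toSubring ∧ IsFractionRing R K ∧
      ∃ α : G K ⧸ N p K, DivIntegral p k K R O α ∧ α ∉ Unr p K O.toSubring := by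
  rintro ⟨p, hp, k, K, _, _, _, _, _, -, O, -, hdvr, hperf, R, -, -, -, α, -, hα⟩
  haveI : CharP K p := charP_of_injective_algebraMap (algebraMap k K).injective p
  rw [unr_eq_top_of_dvr_of_perfect_residue hp O hdvr hperf] at hα
  exact hα trivial

/-- **CALIBRATION (negative lemma): no `WildSymbol` witness at a zero-dimensional discrete place.**
The crux with the extra hypotheses "`O` is a discrete valuation ring" and "the residue field of `O`
is `k`" (`∀ u ∈ O, ∃ c ∈ k, u − c ∈ 𝔪_O`) is FALSE: such `O` absorb every class
(`unr_eq_top_of_dvr_of_residueField`), so condition (N) `α ∉ Unr O` fails — whatever the affine model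
`R` and condition (D). These places are NOT in the tested divisorial class as soon as trdeg `K/k ≥ 2`
(they are not essentially of finite type), so this is a new excluded region, and it is the first
class of DEFECT-prone (non-Abhyankar) places shown to carry no witness: "degree-3 classes are blind"
there. For the line `birth`: a self-similar germ whose basin ring `⋃ σⁿ(S)` is discrete with residue
field `k` (e.g. the transcendental invariant branch of `(x, y) ↦ (x/q, qy/x − 1)` on `k(x,y)`) cannot
exist. [folklore] -/
theorem not_wildSymbol_at_arc_place :
    ¬ ∃ p : ℕ, p.Prime ∧ ∃ (k K : Type) (_ : Field k) (_ : CharP k p) (_ : PerfectField k) (_ : Field K)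
      (_ : Algebra k K), (⊤ : IntermediateField k K).FG ∧ ∃ O : ValuationSubring K,
      (∀ c : k, algebraMap k K c ∈ O) ∧ IsDiscreteValuationRing O ∧
      (∀ u : K, u ∈ O → ∃ c : k, u - algebraMap k K c ∈ O.nonunits) ∧
      ∃ R : Subalgebra k K, R.FG ∧ R.toSubring ≤ O.toSubring ∧ IsFractionRing R K ∧
      ∃ α : G K ⧸ N p K, DivIntegral p k K R O α ∧ α ∉ Unr p K O.toSubring := by
  rintro ⟨p, hp, k, K, _, _, _, _, _, -, O, -, hdvr, hres, R, -, -, -, α, -, hα⟩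
  haveI : CharP K p := charP_of_injective_algebraMap (algebraMap k K).injective p
  rw [unr_eq_top_of_dvr_of_residueField hp O hdvr hres] at hα
  exact hα trivial

end Arc

end Summit.ResolutionOfSingularities.ResolutionOfSingularities.Theorems.WildSymbol.Birth

end
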